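import Literature.Geometry.Kaehler.ComplexTorusFourierHodgeClasses
import Literature.Geometry.Kaehler.ComplexTorusIntegralHodgeClassesRank
import Literature.Geometry.Kaehler.ComplexTorusHardLefschetz
import HarnessLib

/-!
# The Fourier transform identifies the integral lattices of `X` and `X̂`: `F : Hᵖ(X, ℤ) ⥲ H^{2g−p}(X̂, ℤ)` and
# `F : Hdgᵖ(X, ℤ) ⥲ Hdg^{g−p}(X̂, ℤ)` as `ℤ`-linear ISOMORPHISMS; `rk Hdg^{g−p}(X̂, ℤ) = rk Hdgᵖ(X, ℤ)`, and
# `rk Hdgᵖ(X̂, ℤ) = rk Hdgᵖ(X, ℤ)` when `X` carries a non-degenerate `NS`-class (every abelian variety)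

Layer `Literature/Geometry/Kaehler`, namespace `Literature.Geometry.Kaehler.ComplexTorus`; lane `lit-hodgefound` (Track 2
foundations library), seat p09, generation 31, row g31-#9. THEOREMS ONLY (0 definitions); no named fact, net debt 0. The INTEGRAL
packaging of the tree's Fourier theory of a complex torus `X = E/Φ(ℤ^ι)` and its dual `X̂ = Ω̄/Λ̂` (`dualPeriod Φ`):
`ComplexTorusFourierIsomorphism` (Lange 2023 Prop. 6.2.20, p. 310: "The Fourier transform `F` is an isomorphism" `Hᵖ(X, ℤ) →
H^{2g−p}(X̂, ℤ)` — the tree's `fourierForm_mem_integralForms`, `exists_fourierForm_eq_of_mem_integralForms`, `fourierForm_injective`),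
`ComplexTorusFourierHodgeClasses` (Prop. 6.2.21, p. 311: "`F(H^{r,s}(X)) = H^{g−s,g−r}(X̂)`", read for `r = s = p` — the tree's
`fourierForm_mem_integralHodgeClasses`, `exists_mem_integralHodgeClasses_fourierForm_eq` and the `ℚ`-linear bijection
`exists_linearMap_hodgeClasses_fourierForm_bijective` / `finrank_hodgeClasses_dualPeriod_eq`). Those files package `F` over `ℚ`;
here it is packaged over `ℤ`, on the lattices themselves:

* §1 **`F : Hᵖ(X, ℤ) → Hᵐ(X̂, ℤ)` (`p + m = 2g`) is a `ℤ`-linear BIJECTION** of free abelian groups; `rk_ℤ Hᵐ(X̂, ℤ) = rk_ℤ Hᵖ(X, ℤ)`.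
* §2 **`F : Hdgᵖ(X, ℤ) → Hdg^q(X̂, ℤ)` (`p + q = g`) is a `ℤ`-linear BIJECTION**; **`rk_ℤ Hdg^q(X̂, ℤ) = rk_ℤ Hdgᵖ(X, ℤ)`** — the
  integral Hodge lattices of `X` and `X̂` correspond in complementary codimension, for EVERY complex torus.
* §3 with the hard Lefschetz symmetry `rk Hdgᵖ(X, ℤ) = rk Hdg^{g−p}(X, ℤ)` of a torus carrying a non-degenerate `NS`-class (the tree's
  `finrank_hodgeClasses_eq_of_add_eq`, Lange §7.3.2 (1)): **`rk_ℤ Hdgᵖ(X̂, ℤ) = rk_ℤ Hdgᵖ(X, ℤ)`** in every codimension, in particular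
  for every abelian variety and its dual.

## Contents (theorems only)

* §1 **`exists_intLinearMap_integralForms_fourierForm_bijective`**, `finrank_integralForms_dualPeriod_eq`.
* §2 **`exists_intLinearMap_integralHodgeClasses_fourierForm_bijective`**, **`finrank_integralHodgeClasses_dualPeriod_eq`**.
* §3 **`finrank_integralHodgeClasses_dualPeriod_eq_self`**, `IsRiemannForm.finrank_integralHodgeClasses_dualPeriod_eq_self`,
  `IsAbelianVariety.finrank_integralHodgeClasses_dualPeriod_eq_self`; `finrank_hodgeClasses_dualPeriod_eq_self` (the `ℚ` form).

## References

* [cite: Lange2023AbelianVarietiesComplex, §6.2.4 Prop. 6.2.20 (p. 310) and Prop. 6.2.21 (p. 311); §7.3.2 (1) (PDF p. 338); §7.2.2]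
* [cite: Beauville1983Fourier] (Lange's source [15] for §6.2; cited through Lange)
-/

noncomputable section

open Module Function

universe uE

namespace Literature.Geometry.Kaehler.ComplexTorus

section FourierLattices

variable {ι : Type*} [Fintype ι] [LinearOrder ι] {E : Type uE} [NormedAddCommGroup E] [NormedSpace ℂ E]
  (Φ : (ι → ℝ) ≃L[ℝ] E) {p q m : ℕ}

/-! ## §1 `F : Hᵖ(X, ℤ) ⥲ Hᵐ(X̂, ℤ)` -/

/-- **Prop. 6.2.20 on the lattices: `F : Hᵖ(X, ℤ) → Hᵐ(X̂, ℤ)` (`p + m = 2g = |ι|`) is a `ℤ`-linear bijection** ("The Fourier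
transform `F` is an isomorphism" `Hᵖ(X, ℤ) → H^{2g−p}(X̂, ℤ)`), packaged as the existence of a `ℤ`-linear map between the two lattices
with underlying function `F` (integrality: `fourierForm_mem_integralForms`; onto: `exists_fourierForm_eq_of_mem_integralForms`;
injective: `fourierForm_injective`). [cite: Lange2023AbelianVarietiesComplex, §6.2.4 Prop. 6.2.20 p. 310] -/
theorem exists_intLinearMap_integralForms_fourierForm_bijective (e : Fin (p + m) ≃ ι) :
    ∃ F : AddSubgroup.toIntSubmodule (integralForms Φ p) →ₗ[ℤ] AddSubgroup.toIntSubmodule (integralForms (dualPeriod Φ) m),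
      (∀ x, (F x : (E →L⋆[ℂ] ℂ) [⋀^Fin m]→L[ℝ] ℂ) = fourierForm Φ e rfl x) ∧ Bijective F := by
  let F : AddSubgroup.toIntSubmodule (integralForms Φ p) →ₗ[ℤ] AddSubgroup.toIntSubmodule (integralForms (dualPeriod Φ) m) :=
    (AddMonoidHom.mk' (fun x : AddSubgroup.toIntSubmodule (integralForms Φ p) ↦
        (⟨fourierForm Φ e rfl x, fourierForm_mem_integralForms Φ e x.2⟩ :
          AddSubgroup.toIntSubmodule (integralForms (dualPeriod Φ) m)))
      fun a b ↦ Subtype.ext (fourierForm_add Φ e rfl _ _)).toIntLinearMap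
  refine ⟨F, fun _ ↦ rfl, fun x x' h ↦ Subtype.ext (fourierForm_injective Φ e ?_), fun y ↦ ?_⟩
  · exact congrArg (fun z : AddSubgroup.toIntSubmodule (integralForms (dualPeriod Φ) m) ↦
      (z : (E →L⋆[ℂ] ℂ) [⋀^Fin m]→L[ℝ] ℂ)) h
  · have hy : (y : (E →L⋆[ℂ] ℂ) [⋀^Fin m]→L[ℝ] ℂ) ∈ integralForms (dualPeriod Φ) m := y.2
    obtain ⟨x, hx, hFx⟩ := exists_fourierForm_eq_of_mem_integralForms Φ e hy
    exact ⟨⟨x, hx⟩, Subtype.ext hFx⟩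

/-- **`rk_ℤ Hᵐ(X̂, ℤ) = rk_ℤ Hᵖ(X, ℤ)` for `p + m = 2g`** (through the Fourier isomorphism).
[cite: Lange2023AbelianVarietiesComplex, §6.2.4 Prop. 6.2.20 p. 310] -/
theorem finrank_integralForms_dualPeriod_eq (e : Fin (p + m) ≃ ι) :
    finrank ℤ (AddSubgroup.toIntSubmodule (integralForms (dualPeriod Φ) m)) =
      finrank ℤ (AddSubgroup.toIntSubmodule (integralForms Φ p)) := by
  obtain ⟨F, -, hF⟩ := exists_intLinearMap_integralForms_fourierForm_bijective Φ (p := p) (m := m) e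
  exact ((LinearEquiv.ofBijective F hF).finrank_eq).symm

/-! ## §2 `F : Hdgᵖ(X, ℤ) ⥲ Hdg^q(X̂, ℤ)`, `p + q = g` -/

/-- **`F : Hdgᵖ(X, ℤ) → Hdg^q(X̂, ℤ)` (`p + q = g`) is a `ℤ`-linear bijection of the integral Hodge lattices** (Prop. 6.2.20 ∧ 6.2.21:
`F` is integral-bijective and `F(H^{p,p}(X)) = H^{q,q}(X̂)`; the tree's `fourierForm_mem_integralHodgeClasses` and
`exists_mem_integralHodgeClasses_fourierForm_eq`). [cite: Lange2023AbelianVarietiesComplex, §6.2.4 Prop. 6.2.20 p. 310 and Prop. 6.2.21 p. 311] -/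
theorem exists_intLinearMap_integralHodgeClasses_fourierForm_bijective (e : Fin (2 * p + 2 * q) ≃ ι) :
    ∃ F : integralHodgeClasses Φ p →ₗ[ℤ] integralHodgeClasses (dualPeriod Φ) q,
      (∀ x, (F x : (E →L⋆[ℂ] ℂ) [⋀^Fin (2 * q)]→L[ℝ] ℂ) = fourierForm Φ e rfl x) ∧ Bijective F := by
  let F : integralHodgeClasses Φ p →ₗ[ℤ] integralHodgeClasses (dualPeriod Φ) q :=
    (AddMonoidHom.mk' (fun x : integralHodgeClasses Φ p ↦
        (⟨fourierForm Φ e rfl x, fourierForm_mem_integralHodgeClasses Φ e x.2⟩ : integralHodgeClasses (dualPeriod Φ) q))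
      fun a b ↦ Subtype.ext (fourierForm_add Φ e rfl _ _)).toIntLinearMap
  refine ⟨F, fun _ ↦ rfl, fun x x' h ↦ Subtype.ext (fourierForm_injective Φ e ?_), fun y ↦ ?_⟩
  · exact congrArg (fun z : integralHodgeClasses (dualPeriod Φ) q ↦ (z : (E →L⋆[ℂ] ℂ) [⋀^Fin (2 * q)]→L[ℝ] ℂ)) h
  · obtain ⟨x, hx, hFx⟩ := exists_mem_integralHodgeClasses_fourierForm_eq Φ e y.2
    exact ⟨⟨x, hx⟩, Subtype.ext hFx⟩

/-- **`rk_ℤ Hdg^q(X̂, ℤ) = rk_ℤ Hdgᵖ(X, ℤ)` for `p + q = g`, on every complex torus** (the `ℚ`-form is the tree's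
`finrank_hodgeClasses_dualPeriod_eq`). [cite: Lange2023AbelianVarietiesComplex, §6.2.4 Prop. 6.2.20 p. 310 and Prop. 6.2.21 p. 311; §7.2.2] -/
theorem finrank_integralHodgeClasses_dualPeriod_eq (e : Fin (2 * p + 2 * q) ≃ ι) :
    finrank ℤ (integralHodgeClasses (dualPeriod Φ) q) = finrank ℤ (integralHodgeClasses Φ p) := by
  obtain ⟨F, -, hF⟩ := exists_intLinearMap_integralHodgeClasses_fourierForm_bijective Φ (p := p) (q := q) e
  exact ((LinearEquiv.ofBijective F hF).finrank_eq).symm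

/-! ## §3 With hard Lefschetz: `rk Hdgᵖ(X̂, ℤ) = rk Hdgᵖ(X, ℤ)` -/

/-- **`dim_ℚ Bᵖ(X̂) = dim_ℚ Bᵖ(X)`** for a complex torus with a non-degenerate `η ∈ NS(X)` (Fourier: `dim Bᵖ(X̂) = dim B^q(X)`,
`p + q = g`; hard Lefschetz: `dim B^q(X) = dim Bᵖ(X)`). [cite: Lange2023AbelianVarietiesComplex, §6.2.4 Prop. 6.2.21 p. 311 and §7.3.2 (1)] -/
theorem finrank_hodgeClasses_dualPeriod_eq_self [FiniteDimensional ℂ E] {η : E [⋀^Fin 2]→L[ℝ] ℝ} (hηNS : IsNSForm Φ η)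
    (hη : ∀ v : E, v ≠ 0 → ∃ w : E, η ![v, w] ≠ 0) (e : Fin (2 * p + 2 * q) ≃ ι) :
    finrank ℚ (hodgeClasses (dualPeriod Φ) p) = finrank ℚ (hodgeClasses Φ p) := by
  have hg : finrank ℂ E = q + p := finrank_eq_add_of_equiv Φ e
  rw [finrank_hodgeClasses_dualPeriod_eq Φ (p := q) (q := p) ((finCongr (Nat.add_comm (2 * q) (2 * p))).trans e)]
  exact finrank_hodgeClasses_eq_of_add_eq Φ hηNS hη hg.symm

/-- **`rk_ℤ Hdgᵖ(X̂, ℤ) = rk_ℤ Hdgᵖ(X, ℤ)` in every codimension** for a complex torus with a non-degenerate `NS`-class (every abelian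
variety): `X` and `X̂` have integral Hodge lattices of the same ranks. [cite: Lange2023AbelianVarietiesComplex, §6.2.4 Prop. 6.2.20–6.2.21 and §7.3.2 (1); §7.2.2] -/
theorem finrank_integralHodgeClasses_dualPeriod_eq_self [FiniteDimensional ℂ E] {η : E [⋀^Fin 2]→L[ℝ] ℝ} (hηNS : IsNSForm Φ η)
    (hη : ∀ v : E, v ≠ 0 → ∃ w : E, η ![v, w] ≠ 0) (e : Fin (2 * p + 2 * q) ≃ ι) :
    finrank ℤ (integralHodgeClasses (dualPeriod Φ) p) = finrank ℤ (integralHodgeClasses Φ p) := by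
  rw [finrank_integralHodgeClasses_eq_finrank_hodgeClasses, finrank_integralHodgeClasses_eq_finrank_hodgeClasses]
  exact finrank_hodgeClasses_dualPeriod_eq_self Φ hηNS hη e

/-- The same on a polarised torus. [cite: Lange2023AbelianVarietiesComplex, §6.2.4 Prop. 6.2.20–6.2.21 and §7.3.2 (1)] -/
theorem IsRiemannForm.finrank_integralHodgeClasses_dualPeriod_eq_self [FiniteDimensional ℂ E] {η : E [⋀^Fin 2]→L[ℝ] ℝ}
    (hη : IsRiemannForm Φ η) (e : Fin (2 * p + 2 * q) ≃ ι) :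
    finrank ℤ (integralHodgeClasses (dualPeriod Φ) p) = finrank ℤ (integralHodgeClasses Φ p) :=
  ComplexTorus.finrank_integralHodgeClasses_dualPeriod_eq_self Φ hη.isNSForm (IsRiemannForm.exists_apply_ne_zero Φ hη) e

/-- **An abelian variety and its dual have integral Hodge lattices of the same rank in every codimension.**
[cite: Lange2023AbelianVarietiesComplex, §6.2.4 Prop. 6.2.20–6.2.21 and §7.3.2 (1)] -/
theorem IsAbelianVariety.finrank_integralHodgeClasses_dualPeriod_eq_self [FiniteDimensional ℂ E] (hX : IsAbelianVariety Φ)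
    (e : Fin (2 * p + 2 * q) ≃ ι) :
    finrank ℤ (integralHodgeClasses (dualPeriod Φ) p) = finrank ℤ (integralHodgeClasses Φ p) := by
  obtain ⟨η, hη⟩ := hX
  exact hη.finrank_integralHodgeClasses_dualPeriod_eq_self Φ e

end FourierLattices

end Literature.Geometry.Kaehler.ComplexTorus
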